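/-
Copyright (c) 2026 the pub-hodgecm-mathlib formalisation cell (harness21).  Prover seat hodgecm-mathlib-LH4-p05 (g4), req620 Track A «(D-RAM) FOUR-FRAME» squad
(unit U3_Laws, (KSS²) road after the (R-22) «κS-RECUT»: «κS-TRUNK, TYPE 2» — the EXACT SIGNED value of the type-2 κ-Stage-B sum WITH MULTIPLICITY, glue witnesses as binders;
LH4-p11 (g3)'s ★ (κ-B₂) payer p856967 `kappaCount_typeTwo_mult_of_boxSum` re-run WITHOUT the absolute value over his ★ κ-BOX-SUM₂ p856964; the type-2 twin (A₂) of LH4-p04 (g3)'s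
KSB02-PAYER-PLAN v1 §2 (A)).  2026-09-04.
-/
import Summits.HodgeConjecture.HodgeConjecture.Theorems.F0P3cDyRamKappaCountTypeTwo      -- ★ p856967 (LH4-p11 (g3)): the (κ-B₂) payer modulo box-sum; brings every ★ type-2 κ-socket, ★ type-2 strata decomposition, ★ glue witnesses, ★ §P rotations
import Summits.HodgeConjecture.HodgeConjecture.Theorems.F0P3cDyRamKappaCountBoxSumTwo   -- ★ p856964 (LH4-p11 (g3)): `sum_box_kappa_eq_typeTwo` — «κ-BOX-SUM₂», sign tokens free
import HarnessLib

/-!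
# Crux `H413`, line LH4 «(D-RAM) FOUR-FRAME» road — unit U3_Laws (iii), (KSS²) road: «κS-TRUNK, TYPE 2» — THE EXACT SIGNED VALUE OF THE TYPE-2 κ-STAGE-B SUM WITH MULTIPLICITY
# `Σᶠ_{M ∈ 𝓛₀(T), IsTypeTwoPolarisable} κ₂,ᵢ(M)·w(M) = TOK(f₀, f₁, f₂; apex, i) · ampl(q, k, B + tauOfRecord d)∕4` for ANY σ-fixed glue witnesses `f₀, f₁, f₂` of the three feet

Cell `hodgecm-mathlib` (D-0151), FLOOR 0, crux item H413 = `stmt-HodgeConjecture-24833`, route of record `HCCMUnconditional`; squad F0∕P3c∕LH4 (req618∕req620); registered stub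
concerned: (κS-B₂²) `F0P3cDyRamFourFrameU3.stub_U3_kappaSignCount2_typeTwo_mult` (U3 ED. 13 «κS-RECUT (R-22)», the re-lettered SIGNED type-2 κ-Stage-B child with multiplicity:
`Σᶠ κ₂,ᵢ·w = (omegaR_i · w_i · baseSign_i · ω(fPartProd δ (a,b,1) i)) · ampl(q, k, B + tauOfRecord d)∕4` at the square datum).  THEOREMS ONLY (no `def`, no instance, no notation,
no `sorry`, default heartbeats); lane `--supports stmt-HodgeConjecture-24833 --as helper` (count-neutral).

WHY.  The type-2 twin of «κS-TRUNK, TYPE 0» (`…KappaCountTypeZeroSigned`): LH4-p11 (g3)'s ★ `kappaCount_typeTwo_mult_of_boxSum` (p856967) proves the UNSIGNED child `|Σᶠ κ₂,ᵢ·w| =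
ampl(q, k, B + τ d)∕4` by (1)+(2) the ★ type-2 strata decomposition over the box (LH4-p10 (g3) `finsum_mem_typeTwoPolarisable_eq_sum_box_finsum_mem_stratumTwo`), (3) the ★ type-2
κ-sockets cell by cell (T₂ ★ p856737; G₁ at every `ρ ≥ 0` ★ `…GluedSocketTwoZero` and H₂ ★ `…CoreHangingTwoSocket` at a σ-fixed glue witness `f₀` of `−(β−1)∕(α−1)`; G₂∕G₃ ★
`…GluedTwoRotationsAll` p856915 at witnesses `f₁`, `f₂` of the swapped ∕ rescaled element data), (4) ★ κ-BOX-SUM₂ `sum_box_kappa_eq_typeTwo` (p856964) with the sockets' signs as its free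
tokens, and (5) `|token| = 1`.  Step (5) throws away exactly what the SIGNED child needs.  THIS FILE re-runs (1)–(4) with the three witnesses as BINDERS (any σ-fixed `f₀, f₁, f₂` with
the ★ `exists_glue_witness` depth bounds) and stops before (5): the sum EQUALS the sign token `TOK` of the box-sum — the SAME witness table as at type 0 (T18-53 Q5: the glue signs are
type-blind; equilateral H letters `(ω(−(1+f₀)), ω(f₀)ω(−(1+f₀)), ω(f₀))_i`, apex feet `εG p i`) — times `ampl(q, k, B + tauOfRecord d)∕4`.  The (κS-B₂²) payer is then TRUNK₂ ⊕ the SAME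
Ω-dictionary bricks as at type 0 (KSB02-PAYER-PLAN v1 (C0)(C1), type-blind) ⊕ `0 = 0` on the dead axes; the (κ-B₂) child itself is `|TOK| = 1` applied to this theorem.

THE MATHEMATICS.  ★ p856967's proof, steps (1)–(4) VERBATIM, then (6′) division by `q − 1` and `max(0, q^k − q^{k−(B+τ)}) = q^k − q^{k−B₂}`, `B₂ = (nᵢ + 4 − 2(d%2) − 3d)⁺∕2` — no
absolute value.

WHAT IS PROVED.
* `finsum_kappaCount_typeTwo_eq_token_mul_ampl (hD) (h2) (hE) (T) (hT) (k) (hk) (i) (B) (hB) (hσf₀) (hσf₁) (hσf₂) (hf₀) (hf₁) (hf₂')` — the displayed identity; the witness bounds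
  are EXACTLY what ★ `exists_glue_witness hD hE hN₀` ∕ `… (isElementDatum_swap hE) …` ∕ `… (isElementDatum_rescale hvσ hE) …` deliver.
HONEST LABEL.  Count-neutral (`--supports`); a kernel identity about the diagonal model (pure lattice counting + box arithmetic), NOT a census law and NOT a literature fact; (κS-B₂²)
stays a PROVER TARGET until the dictionary assembler lands; `HC_CM` is proved only modulo the 7 printed citations (2 remaining named inputs: hLiu418 = `stmt-HodgeConjecture-24832`,
h413 = `stmt-HodgeConjecture-24833`) until rung 0 closes.

## References
* [Kottwitz1986BaseChangeUnits] R. E. Kottwitz, *Base change for unit elements of Hecke algebras*, Compositio Math. 60 (1986), §1 pp. 240–241 (κ-orbital integrals of units as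
  signed lattice counts modulo the torus).
* [Rogawski1990] J. D. Rogawski, *Automorphic Representations of Unitary Groups in Three Variables*, Ann. of Math. Stud. 123 (1990), §4.9 Prop. 4.9.1 (a) p. 55, §4.10 p. 58.
* [LanglandsShelstad1987] R. P. Langlands, D. Shelstad, *On the definition of transfer factors*, Math. Ann. 278 (1987), §3 (κ as a character of `H¹(F, T)`).
-/

set_option autoImplicit false

noncomputable section

namespace Summit.HodgeConjecture.HodgeConjecture.Cruxes.H413.F0P3cDyRamKappaCountTypeTwoSigned

open Finset
open Literature.NumberTheory.Automorphic Literature.NumberTheory.Automorphic.HermitianLattice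
open Literature.NumberTheory.Automorphic.UnitaryLatticeTree Literature.NumberTheory.Automorphic.UnitaryThreeFourFrame
open Literature.NumberTheory.LocalFields Literature.NumberTheory.LocalFields.WildQuadraticDatum
open Summit.HodgeConjecture.HodgeConjecture.Cruxes.H413.F0P3cDyRamFourFrameLawDefsR (shiftR)
open Summit.HodgeConjecture.HodgeConjecture.Cruxes.H413.F0P3cDyRamDiagonalTorusDefs
open Summit.HodgeConjecture.HodgeConjecture.Cruxes.H413.F0P3cDyRamDiagonalStrataDefs
open Summit.HodgeConjecture.HodgeConjecture.Cruxes.H413.F0P3cDyRamDiagonalKappaCountDefs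
open Summit.HodgeConjecture.HodgeConjecture.Cruxes.H413.F0P3cDyRamElementDatumParity
open Summit.HodgeConjecture.HodgeConjecture.Cruxes.H413.F0P3cDyRamStrataDecompositionGeneric
open Summit.HodgeConjecture.HodgeConjecture.Cruxes.H413.F0P3cDyRamDiagonalKappaSplitCountTwoSockets
open Summit.HodgeConjecture.HodgeConjecture.Cruxes.H413.F0P3cDyRamDiagonalKappaGluedSocketTwoZero (finsum_kappaCount_two_mul_stabiliserWeight_hasAxis_G1_all)
open Summit.HodgeConjecture.HodgeConjecture.Cruxes.H413.F0P3cDyRamDiagonalKappaGluedTwoRotationsAll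
open Summit.HodgeConjecture.HodgeConjecture.Cruxes.H413.F0P3cDyRamDiagonalKappaCoreHangingTwoSocket (finsum_kappaCount_mul_stabiliserWeight_hasAxis_H_two)
open Summit.HodgeConjecture.HodgeConjecture.Cruxes.H413.F0P3cDyRamDiagonalPermutation (isElementDatum_swap isElementDatum_rescale)
open Summit.HodgeConjecture.HodgeConjecture.Cruxes.H413.F0P3cDyRamKappaAssemblyTools
open Summit.HodgeConjecture.HodgeConjecture.Cruxes.H413.F0P3cDyRamDiagonalKappaCoreHangingClass (two_le_d_of_v_two_lt_one)
open scoped Valued WithZero Matrix MatrixGroups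

open Summit.HodgeConjecture.HodgeConjecture.Cruxes.H413.F0P3cDyRamKappaCountBoxSumTwo (sum_box_kappa_eq_typeTwo)

/-! ## §1  THE SIGNED TYPE-2 κ-STAGE-B SUM WITH MULTIPLICITY at three glue witnesses -/

/-- **«κS-TRUNK, TYPE 2» — THE EXACT SIGNED VALUE OF THE TYPE-2 κ-STAGE-B SUM WITH MULTIPLICITY.**  For a wild ramified quadratic datum on a complete field with finite residue
field (`|2| < 1`), an element datum `(α, β; n₁, n₂, n₃)` at the depth of record, `T = diag(α, β, 1)`, `2k + d = n₁ + n₂ + n₃ + 2`, a slot `i`, `2B = nᵢ − d + 2 − 2·shiftR d t`, and ANY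
three σ-fixed glue witnesses `f₀, f₁, f₂` of the three feet (the ★ `exists_glue_witness` bounds on `hE`, the swapped and the rescaled datum, as at type 0):
`Σᶠ_{M ∈ 𝓛₀(T), IsTypeTwoPolarisable} κ₂,ᵢ(M)·w(M) = TOK · ampl(q, k, B + tauOfRecord d)∕4`, `TOK` = the SAME witness sign table as at type 0 (equilateral H letters at `f₀`, else the
apex foot's G letters `εG p i` at `f_p`) — LH4-p11 (g3)'s ★ p856967 sign table VERBATIM, its proof steps (1)–(4) verbatim, no absolute value at the end.  (κ-B₂) = `|TOK| = 1` applied to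
this; (κS-B₂²) = this ⊕ the Ω-dictionary on the read axes.
[cite: Kottwitz1986BaseChangeUnits, §1 pp. 240–241] [cite: Rogawski1990, §4.9 Prop. 4.9.1 (a) p. 55; §4.10 p. 58] [cite: LanglandsShelstad1987, §3] -/
theorem finsum_kappaCount_typeTwo_eq_token_mul_ampl
    {K : Type} [Field K] [Valued K ℤᵐ⁰] [CompleteSpace K] [Fintype 𝓀[K]] {σ : K →+* K} {ϖ : K} {d t : ℕ} (hD : IsRamifiedQuadraticDatum σ ϖ d t)
    (h2 : Valued.v (2 : K) < 1) {α β : K} {n₁ n₂ n₃ : ℕ} (hE : IsElementDatum σ ϖ (depthOfRecord d) α β n₁ n₂ n₃)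
    (T : GL (Fin 3) K) (hT : (T : Matrix (Fin 3) (Fin 3) K) = Matrix.diagonal ![α, β, 1]) (k : ℕ) (hk : 2 * k + d = n₁ + n₂ + n₃ + 2)
    (i : Fin 3) (B : ℤ) (hB : 2 * B = ((![n₁, n₂, n₃] : Fin 3 → ℕ) i : ℤ) - d + 2 - 2 * shiftR d t)
    {f₀ f₁ f₂ : K} (hσf₀ : σ f₀ = f₀) (hσf₁ : σ f₁ = f₁) (hσf₂ : σ f₂ = f₂)
    (hf₀ : n₂ = n₃ → n₂ ≤ n₁ → Valued.v (f₀ + (β - 1) / (α - 1)) ≤ Valued.v ϖ ^ (n₁ - d + 1))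
    (hf₁ : n₁ = n₃ → n₁ ≤ n₂ → Valued.v (f₁ + (α - 1) / (β - 1)) ≤ Valued.v ϖ ^ (n₂ - d + 1))
    (hf₂' : n₂ = n₁ → n₂ ≤ n₃ → Valued.v (f₂ + (β * α⁻¹ - 1) / (α⁻¹ - 1)) ≤ Valued.v ϖ ^ (n₃ - d + 1)) :
    ∑ᶠ M ∈ {M : Submodule 𝒪[K] (Fin 3 → K) | M ∈ normalisedStableLattices T ∧ IsTypeTwoPolarisable σ ϖ M},
        (kappaCount σ ϖ 2 i M : ℚ) * stabiliserWeight σ M =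
      (if n₁ = n₂ ∧ n₂ = n₃ then ((((![normSign σ (-(1 + f₀)), normSign σ f₀ * normSign σ (-(1 + f₀)), normSign σ f₀] : Fin 3 → ℤ) i : ℤ) : ℚ))
      else if n₂ = n₃ then (![![(normSign σ (-1 : K) : ℚ) * normSign σ (1 + f₀), (normSign σ (-1 : K) : ℚ) * normSign σ f₀ * normSign σ (1 + f₀), (normSign σ f₀ : ℚ)],
         ![(normSign σ (-1 : K) : ℚ) * normSign σ f₁ * normSign σ (1 + f₁), (normSign σ (-1 : K) : ℚ) * normSign σ (1 + f₁), (normSign σ f₁ : ℚ)],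
         ![(normSign σ f₂ : ℚ), (normSign σ (-1 : K) : ℚ) * normSign σ f₂ * normSign σ (1 + f₂), (normSign σ (-1 : K) : ℚ) * normSign σ (1 + f₂)]] : Fin 3 → Fin 3 → ℚ) 0 i
      else if n₁ = n₃ then (![![(normSign σ (-1 : K) : ℚ) * normSign σ (1 + f₀), (normSign σ (-1 : K) : ℚ) * normSign σ f₀ * normSign σ (1 + f₀), (normSign σ f₀ : ℚ)],
         ![(normSign σ (-1 : K) : ℚ) * normSign σ f₁ * normSign σ (1 + f₁), (normSign σ (-1 : K) : ℚ) * normSign σ (1 + f₁), (normSign σ f₁ : ℚ)],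
         ![(normSign σ f₂ : ℚ), (normSign σ (-1 : K) : ℚ) * normSign σ f₂ * normSign σ (1 + f₂), (normSign σ (-1 : K) : ℚ) * normSign σ (1 + f₂)]] : Fin 3 → Fin 3 → ℚ) 1 i
      else (![![(normSign σ (-1 : K) : ℚ) * normSign σ (1 + f₀), (normSign σ (-1 : K) : ℚ) * normSign σ f₀ * normSign σ (1 + f₀), (normSign σ f₀ : ℚ)],
         ![(normSign σ (-1 : K) : ℚ) * normSign σ f₁ * normSign σ (1 + f₁), (normSign σ (-1 : K) : ℚ) * normSign σ (1 + f₁), (normSign σ f₁ : ℚ)],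
         ![(normSign σ f₂ : ℚ), (normSign σ (-1 : K) : ℚ) * normSign σ f₂ * normSign σ (1 + f₂), (normSign σ (-1 : K) : ℚ) * normSign σ (1 + f₂)]] : Fin 3 → Fin 3 → ℚ) 2 i) *
        (ampl (Fintype.card 𝓀[K]) k (B + tauOfRecord d) / 4) := by
  have hD' := hD
  obtain ⟨hσ, hvσ, hϖ, hfix, hdϖ, hd1, -⟩ := hD'
  have hd2 : 2 ≤ d := two_le_d_of_v_two_lt_one hD h2
  have hN₀ : d ≤ depthOfRecord d := by unfold depthOfRecord; split_ifs <;> omega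
  have hϖ1 : Valued.v ϖ ≤ 1 := by rw [hϖ, ← WithZero.exp_zero, WithZero.exp_le_exp]; norm_num
  have hE' := hE
  obtain ⟨hαn, hβn, hαβ, hα1, hβ1, h₁, h₂, h₃, hN₁, hN₂, hN₃⟩ := hE'
  -- (1)+(2) the measure-side split into type-2 strata over the box `[0, n₁+n₂+n₃]³` (★ LH4-p10 (g3), generic in the summand)
  rw [finsum_mem_typeTwoPolarisable_eq_sum_box_finsum_mem_stratumTwo hD hE T hT (le_refl (n₁ + n₂ + n₃))
    (fun M => (kappaCount σ ϖ 2 i M : ℚ) * stabiliserWeight σ M)]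
  -- (3) the glue witnesses of the three feet are BINDERS here (foot 0 ∕ H share `(β−1)∕(α−1)`; feet 1, 2 live on the swapped ∕ rescaled element data)
  have hα0 : α ≠ 0 := fun h => by rw [h, zero_mul] at hαn; exact zero_ne_one hαn
  have hf₂ : n₂ = n₁ → n₂ ≤ n₃ → Valued.v (f₂ + (β - α) / (1 - α)) ≤ Valued.v ϖ ^ (n₃ - d + 1) := by
    intro h21 h23
    have key : (β * α⁻¹ - 1) / (α⁻¹ - 1) = (β - α) / (1 - α) := by
      have h1α : (1 : K) - α ≠ 0 := sub_ne_zero.2 (Ne.symm hα1)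
      have hi : α⁻¹ - 1 = (1 - α) * α⁻¹ := by field_simp
      have hn : β * α⁻¹ - 1 = (β - α) * α⁻¹ := by field_simp
      rw [hi, hn, mul_div_mul_right _ _ (inv_ne_zero hα0)]
    rw [← key]; exact hf₂' h21 h23
  -- (4) the glue-shell guards of the four socket families from the three witnesses (type 2: third exponent `2ρ+1`)
  have hglue₀ : ∀ ρ s : ℕ, 2 ∣ s → n₂ = n₃ → n₁ = n₂ + s → n₂ < 2 * ρ + 1 → 2 * ρ + 1 ≤ 2 * n₂ → 2 * ρ + 1 - n₂ ≤ n₂ - d + 1 →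
      Valued.v (f₀ + (β - 1) / (α - 1)) ≤ Valued.v ϖ ^ (2 * ρ + 1 + s - n₂) := fun ρ s _ h23 h1s hlt _ hle =>
    (hf₀ h23 (by omega)).trans (pow_le_pow_right_of_le_one' hϖ1 (by omega))
  have hglue₁ : ∀ ρ s : ℕ, 2 ∣ s → n₁ = n₃ → n₂ = n₁ + s → n₁ < 2 * ρ + 1 → 2 * ρ + 1 ≤ 2 * n₁ → 2 * ρ + 1 - n₁ ≤ n₁ - d + 1 →
      Valued.v (f₁ + (α - 1) / (β - 1)) ≤ Valued.v ϖ ^ (2 * ρ + 1 + s - n₁) := fun ρ s _ h13 h2s hlt _ hle =>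
    (hf₁ h13 (by omega)).trans (pow_le_pow_right_of_le_one' hϖ1 (by omega))
  have hglue₂ : ∀ ρ s : ℕ, 2 ∣ s → n₂ = n₁ → n₃ = n₂ + s → n₂ < 2 * ρ + 1 → 2 * ρ + 1 ≤ 2 * n₂ → 2 * ρ + 1 - n₂ ≤ n₂ - d + 1 →
      Valued.v (f₂ + (β - α) / (1 - α)) ≤ Valued.v ϖ ^ (2 * ρ + 1 + s - n₂) := fun ρ s _ h21 h3s hlt _ hle =>
    (hf₂ h21 (by omega)).trans (pow_le_pow_right_of_le_one' hϖ1 (by omega))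
  have hglueH : ∀ ρ : ℕ, n₁ = n₂ → n₂ = n₃ → n₁ < 2 * ρ + 1 → 2 * ρ + 1 ≤ 2 * n₁ → 2 * ρ + 1 - n₁ ≤ n₁ - d + 1 →
      Valued.v (f₀ + (β - 1) / (α - 1)) ≤ Valued.v ϖ ^ (2 * ρ + 1 - n₁) := fun ρ h12 h23 hlt _ hle =>
    (hf₀ h23 (by omega)).trans (pow_le_pow_right_of_le_one' hϖ1 (by omega))
  -- the «apex with excess ≥ 2d» guards: there the glue witness is `2d`-deep, so `ω(1 + f) = 1`
  have hvϖ0 : Valued.v ϖ ≠ 0 := by rw [hϖ]; exact WithZero.coe_ne_zero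
  have hdeep : ∀ {f g : K} {e m : ℕ}, Valued.v (f + g) ≤ Valued.v ϖ ^ e → Valued.v g = Valued.v ϖ ^ m → 2 * d ≤ e → 2 * d ≤ m →
      Valued.v f ≤ Valued.v ϖ ^ (2 * d) := by
    intro f g e m hfg hg he hm
    have ef : f = (f + g) - g := by ring
    rw [ef]
    refine (Valuation.map_sub _ _ _).trans (max_le ?_ ?_)
    · exact hfg.trans (pow_le_pow_right_of_le_one' hϖ1 he)
    · rw [hg]; exact pow_le_pow_right_of_le_one' hϖ1 hm
  have hβ0 : β ≠ 0 := fun h => by rw [h, zero_mul] at hβn; exact zero_ne_one hβn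
  have hω0 : i = 0 → n₂ = n₃ → n₂ + 2 * d ≤ n₁ →
      (![![(normSign σ (-1 : K) : ℚ) * normSign σ (1 + f₀), (normSign σ (-1 : K) : ℚ) * normSign σ f₀ * normSign σ (1 + f₀), (normSign σ f₀ : ℚ)],
         ![(normSign σ (-1 : K) : ℚ) * normSign σ f₁ * normSign σ (1 + f₁), (normSign σ (-1 : K) : ℚ) * normSign σ (1 + f₁), (normSign σ f₁ : ℚ)],
         ![(normSign σ f₂ : ℚ), (normSign σ (-1 : K) : ℚ) * normSign σ f₂ * normSign σ (1 + f₂), (normSign σ (-1 : K) : ℚ) * normSign σ (1 + f₂)]] : Fin 3 → Fin 3 → ℚ) 0 0 =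
        (normSign σ (-1 : K) : ℚ) := by
    intro _ h23 hle
    have hg : Valued.v ((β - 1) / (α - 1)) = Valued.v ϖ ^ (n₁ - n₂) := by
      rw [map_div₀, h₁, h₂, div_eq_iff (pow_ne_zero _ hvϖ0), ← pow_add, Nat.sub_add_cancel (by omega)]
    have h1 := normSign_one_add_eq_one hD hσf₀ (hdeep (hf₀ h23 (by omega)) hg (by omega) (by omega))
    show (normSign σ (-1 : K) : ℚ) * normSign σ (1 + f₀) = _
    rw [h1, Int.cast_one, mul_one]
  have hω1 : i = 1 → n₁ = n₃ → n₁ + 2 * d ≤ n₂ →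
      (![![(normSign σ (-1 : K) : ℚ) * normSign σ (1 + f₀), (normSign σ (-1 : K) : ℚ) * normSign σ f₀ * normSign σ (1 + f₀), (normSign σ f₀ : ℚ)],
         ![(normSign σ (-1 : K) : ℚ) * normSign σ f₁ * normSign σ (1 + f₁), (normSign σ (-1 : K) : ℚ) * normSign σ (1 + f₁), (normSign σ f₁ : ℚ)],
         ![(normSign σ f₂ : ℚ), (normSign σ (-1 : K) : ℚ) * normSign σ f₂ * normSign σ (1 + f₂), (normSign σ (-1 : K) : ℚ) * normSign σ (1 + f₂)]] : Fin 3 → Fin 3 → ℚ) 1 1 =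
        (normSign σ (-1 : K) : ℚ) := by
    intro _ h13 hle
    have hg : Valued.v ((α - 1) / (β - 1)) = Valued.v ϖ ^ (n₂ - n₁) := by
      rw [map_div₀, h₁, h₂, div_eq_iff (pow_ne_zero _ hvϖ0), ← pow_add, Nat.sub_add_cancel (by omega)]
    have h1 := normSign_one_add_eq_one hD hσf₁ (hdeep (hf₁ h13 (by omega)) hg (by omega) (by omega))
    show (normSign σ (-1 : K) : ℚ) * normSign σ (1 + f₁) = _
    rw [h1, Int.cast_one, mul_one]
  have hω2 : i = 2 → n₁ = n₂ → n₁ + 2 * d ≤ n₃ →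
      (![![(normSign σ (-1 : K) : ℚ) * normSign σ (1 + f₀), (normSign σ (-1 : K) : ℚ) * normSign σ f₀ * normSign σ (1 + f₀), (normSign σ f₀ : ℚ)],
         ![(normSign σ (-1 : K) : ℚ) * normSign σ f₁ * normSign σ (1 + f₁), (normSign σ (-1 : K) : ℚ) * normSign σ (1 + f₁), (normSign σ f₁ : ℚ)],
         ![(normSign σ f₂ : ℚ), (normSign σ (-1 : K) : ℚ) * normSign σ f₂ * normSign σ (1 + f₂), (normSign σ (-1 : K) : ℚ) * normSign σ (1 + f₂)]] : Fin 3 → Fin 3 → ℚ) 2 2 =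
        (normSign σ (-1 : K) : ℚ) := by
    intro _ h12 hle
    have hg : Valued.v ((β - α) / (1 - α)) = Valued.v ϖ ^ (n₃ - n₂) := by
      rw [map_div₀, Valuation.map_sub_swap _ β α, h₃, Valuation.map_sub_swap _ 1 α, h₂, div_eq_iff (pow_ne_zero _ hvϖ0), ← pow_add,
        Nat.sub_add_cancel (by omega)]
    have h1 := normSign_one_add_eq_one hD hσf₂ (hdeep (hf₂ h12.symm (by omega)) hg (by omega) (by omega))
    show (normSign σ (-1 : K) : ℚ) * normSign σ (1 + f₂) = _
    rw [h1, Int.cast_one, mul_one]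
  -- the foot-2 socket ★ `…_hasAxis_G3_all` is typed `n₂`-based (`n₂ = n₁`, `min n₂ n₁`, `⌈(2ρ+1−n₂)∕2⌉`); `hbox` reads it `n₁`-based
  have hG3' : ∀ ρ s : ℕ, 1 ≤ s → ∑ᶠ M ∈ stratumTwo σ ϖ T ![2 * ρ + 1 + s, 2 * ρ + 1 + s, 2 * ρ + 1], (kappaCount σ ϖ 2 i M : ℚ) * stabiliserWeight σ M =
      (if 2 ∣ s ∧ 2 * ρ + 1 ≤ min n₁ n₂ ∧ 2 * ρ + 1 + s ≤ n₃ then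
          (![0, 0, (normSign σ (-1 : K) : ℚ) * (Fintype.card 𝓀[K] : ℚ) ^ (2 * ρ + s / 2) *
              ((if 2 * d ≤ s then (Fintype.card 𝓀[K] : ℚ) - 1 else 0) - (if s + 2 = 2 * d then 1 else 0))] : Fin 3 → ℚ) i
        else 0) +
      (if 2 ∣ s ∧ n₁ = n₂ ∧ n₃ = n₁ + s ∧ n₁ < 2 * ρ + 1 ∧ 2 * ρ + 1 ≤ 2 * n₁ ∧ 2 * ρ + 1 - n₁ ≤ n₁ - d + 1 then
          (![if d ≤ (2 * ρ + 1 - n₁ + 1) / 2 then (normSign σ f₂ : ℚ) else 0,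
             if d ≤ (2 * ρ + 1 - n₁ + 1) / 2 then (normSign σ (-1 : K) : ℚ) * normSign σ f₂ * normSign σ (1 + f₂) else 0,
             if 2 * d ≤ s + 2 * ((2 * ρ + 1 - n₁ + 1) / 2) then (normSign σ (-1 : K) : ℚ) * normSign σ (1 + f₂) else 0] : Fin 3 → ℚ) i *
            (Fintype.card 𝓀[K] : ℚ) ^ (2 * ρ + s / 2 + 1 - (2 * ρ + 1 - n₁ + 1) / 2)
        else 0) := by
    intro ρ s hs
    rw [finsum_kappaCount_two_mul_stabiliserWeight_hasAxis_G3_all hD h2 hE hN₀ hT ρ s hs i f₂ hσf₂ (hglue₂ ρ s), min_comm n₂ n₁]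
    by_cases h12 : n₁ = n₂
    · rw [← h12]
    · have h21 : ¬ n₂ = n₁ := fun h => h12 h.symm
      simp only [h12, h21, false_and, and_false, if_false]
  -- off the ★ B3₂-γ shape list a type-2 stratum is empty (★ LH4-p10 (g3))
  have hzero : ∀ a : Fin 3 → ℕ, ¬ ((∃ s, ¬ 2 ∣ s ∧ (a = ![0, s, s] ∨ a = ![s, 0, s] ∨ a = ![s, s, 0])) ∨
      (∃ ρ s, 2 ∣ s ∧ 2 ≤ s ∧ (a = ![2 * ρ + 1, 2 * ρ + 1 + s, 2 * ρ + 1 + s] ∨ a = ![2 * ρ + 1 + s, 2 * ρ + 1, 2 * ρ + 1 + s] ∨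
        a = ![2 * ρ + 1 + s, 2 * ρ + 1 + s, 2 * ρ + 1])) ∨
      (∃ ρ, a = ![2 * ρ + 1, 2 * ρ + 1, 2 * ρ + 1])) →
      (fun a => ∑ᶠ M ∈ stratumTwo σ ϖ T a, (kappaCount σ ϖ 2 i M : ℚ) * stabiliserWeight σ M) a = 0 :=
    fun a ha => finsum_mem_stratumTwo_eq_zero_of_not_shape hD T (fun M => (kappaCount σ ϖ 2 i M : ℚ) * stabiliserWeight σ M) a ha
  -- (5) the box sum
  obtain ⟨hp1, hp2, hp3⟩ := depth_mod_two_eq_of_isElementDatum hD hE hN₀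
  have key := sum_box_kappa_eq_typeTwo (Fintype.card 𝓀[K]) hd2 (isoceles_of_isElementDatum hD hE) (le_min_depth_of_isElementDatum hE hN₀) hp1 hp2 hp3 le_rfl hk i
    ((normSign σ (-1 : K) : ℚ))
    ((((![normSign σ (-(1 + f₀)), normSign σ f₀ * normSign σ (-(1 + f₀)), normSign σ f₀] : Fin 3 → ℤ) i : ℤ) : ℚ))
    (![![(normSign σ (-1 : K) : ℚ) * normSign σ (1 + f₀), (normSign σ (-1 : K) : ℚ) * normSign σ f₀ * normSign σ (1 + f₀), (normSign σ f₀ : ℚ)],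
         ![(normSign σ (-1 : K) : ℚ) * normSign σ f₁ * normSign σ (1 + f₁), (normSign σ (-1 : K) : ℚ) * normSign σ (1 + f₁), (normSign σ f₁ : ℚ)],
         ![(normSign σ f₂ : ℚ), (normSign σ (-1 : K) : ℚ) * normSign σ f₂ * normSign σ (1 + f₂), (normSign σ (-1 : K) : ℚ) * normSign σ (1 + f₂)]] : Fin 3 → Fin 3 → ℚ)
    hω0 hω1 hω2
    (fun a => ∑ᶠ M ∈ stratumTwo σ ϖ T a, (kappaCount σ ϖ 2 i M : ℚ) * stabiliserWeight σ M)
    (fun s hs => finsum_kappaCount_two_mul_stabiliserWeight_stratumTwo_T1 hD hE hT s hs i)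
    (fun s hs => finsum_kappaCount_two_mul_stabiliserWeight_stratumTwo_T2 hD hE hT s hs i)
    (fun s hs => finsum_kappaCount_two_mul_stabiliserWeight_stratumTwo_T3 hD hE hT s hs i)
    (fun ρ s hs => finsum_kappaCount_two_mul_stabiliserWeight_hasAxis_G1_all hD h2 hE hN₀ hT ρ s hs i f₀ hσf₀ (hglue₀ ρ s))
    (fun ρ s hs => finsum_kappaCount_two_mul_stabiliserWeight_hasAxis_G2_all hD h2 hE hN₀ hT ρ s hs i f₁ hσf₁ (hglue₁ ρ s))
    hG3'
    (fun ρ => finsum_kappaCount_mul_stabiliserWeight_hasAxis_H_two hD h2 hE hN₀ hT ρ i f₀ hσf₀ (hglueH ρ))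
    hzero
  -- (6) arithmetic: divide by `q − 1`, and `max(0, q^k − q^{k−(B+τ)}) = q^k − q^{k−B₂}` (NO absolute value: the token stays)
  set q : ℕ := Fintype.card 𝓀[K] with hq_def
  have hq1 : (1 : ℚ) < q := by exact_mod_cast (Fintype.one_lt_card : 1 < Fintype.card 𝓀[K])
  have hq1' : (q : ℚ) - 1 ≠ 0 := by linarith
  have hq0 : (0 : ℚ) < q := by linarith
  -- the exponent bookkeeping: `2B = nᵢ − d + 2 − 2·shiftR d t`, `shiftR d t = d − d % 2`, `tauOfRecord d = 1 − 2(d % 2)`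
  have hshift : shiftR d t = ((d - d % 2 : ℕ) : ℤ) := rfl
  rw [hshift] at hB
  have hτ : tauOfRecord d = 1 - 2 * ((d % 2 : ℕ) : ℤ) := by
    unfold tauOfRecord
    rcases Nat.mod_two_eq_zero_or_one d with hε | hε <;> simp [hε]
  have hni : ((![n₁, n₂, n₃] : Fin 3 → ℕ) i) ≤ n₁ + n₂ + n₃ ∧ ((![n₁, n₂, n₃] : Fin 3 → ℕ) i) % 2 = d % 2 := by
    fin_cases i
    · exact ⟨by simp; omega, by simpa using hp1⟩
    · exact ⟨by simp; omega, by simpa using hp2⟩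
    · exact ⟨by simp, by simpa using hp3⟩
  set nᵢ : ℕ := ((![n₁, n₂, n₃] : Fin 3 → ℕ) i) with hnᵢ_def
  have hnum : max 0 ((q : ℚ) ^ (k : ℤ) - (q : ℚ) ^ ((k : ℤ) - (B + tauOfRecord d))) = (q : ℚ) ^ k - (q : ℚ) ^ (k - (nᵢ + 4 - 2 * (d % 2) - 3 * d) / 2) := by
    rw [hτ]
    have hd2' : d % 2 < 2 := Nat.mod_lt d (by norm_num)
    have hdd : d % 2 ≤ d := Nat.mod_le d 2
    by_cases hnn : 3 * d ≤ nᵢ + 4 - 2 * (d % 2)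
    · -- `B + τ = B₂ ≥ 0`, `B₂ ≤ k`
      have hexp : (k : ℤ) - (B + (1 - 2 * ((d % 2 : ℕ) : ℤ))) = (((k - (nᵢ + 4 - 2 * (d % 2) - 3 * d) / 2 : ℕ)) : ℤ) := by omega
      rw [hexp, zpow_natCast, zpow_natCast]
      exact max_eq_right (sub_nonneg.2 (pow_le_pow_right₀ hq1.le (Nat.sub_le _ _)))
    · -- `B + τ < 0`: both sides vanish
      have hB0 : (nᵢ + 4 - 2 * (d % 2) - 3 * d) / 2 = 0 := by
        have : nᵢ + 4 - 2 * (d % 2) - 3 * d = 0 := by omega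
        rw [this]
      have hBneg : (k : ℤ) ≤ (k : ℤ) - (B + (1 - 2 * ((d % 2 : ℕ) : ℤ))) := by omega
      rw [hB0, Nat.sub_zero, sub_self]
      exact max_eq_left (sub_nonpos.2 (zpow_le_zpow_right₀ hq1.le hBneg))
  unfold ampl
  rw [hnum]
  have hsum : ∑ a : Fin 3 → Fin (n₁ + n₂ + n₃ + 1), (fun a => ∑ᶠ M ∈ stratumTwo σ ϖ T a, (kappaCount σ ϖ 2 i M : ℚ) * stabiliserWeight σ M) (fun j => (a j : ℕ)) =
      (if n₁ = n₂ ∧ n₂ = n₃ then ((((![normSign σ (-(1 + f₀)), normSign σ f₀ * normSign σ (-(1 + f₀)), normSign σ f₀] : Fin 3 → ℤ) i : ℤ) : ℚ))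
      else if n₂ = n₃ then (![![(normSign σ (-1 : K) : ℚ) * normSign σ (1 + f₀), (normSign σ (-1 : K) : ℚ) * normSign σ f₀ * normSign σ (1 + f₀), (normSign σ f₀ : ℚ)],
         ![(normSign σ (-1 : K) : ℚ) * normSign σ f₁ * normSign σ (1 + f₁), (normSign σ (-1 : K) : ℚ) * normSign σ (1 + f₁), (normSign σ f₁ : ℚ)],
         ![(normSign σ f₂ : ℚ), (normSign σ (-1 : K) : ℚ) * normSign σ f₂ * normSign σ (1 + f₂), (normSign σ (-1 : K) : ℚ) * normSign σ (1 + f₂)]] : Fin 3 → Fin 3 → ℚ) 0 i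
      else if n₁ = n₃ then (![![(normSign σ (-1 : K) : ℚ) * normSign σ (1 + f₀), (normSign σ (-1 : K) : ℚ) * normSign σ f₀ * normSign σ (1 + f₀), (normSign σ f₀ : ℚ)],
         ![(normSign σ (-1 : K) : ℚ) * normSign σ f₁ * normSign σ (1 + f₁), (normSign σ (-1 : K) : ℚ) * normSign σ (1 + f₁), (normSign σ f₁ : ℚ)],
         ![(normSign σ f₂ : ℚ), (normSign σ (-1 : K) : ℚ) * normSign σ f₂ * normSign σ (1 + f₂), (normSign σ (-1 : K) : ℚ) * normSign σ (1 + f₂)]] : Fin 3 → Fin 3 → ℚ) 1 i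
      else (![![(normSign σ (-1 : K) : ℚ) * normSign σ (1 + f₀), (normSign σ (-1 : K) : ℚ) * normSign σ f₀ * normSign σ (1 + f₀), (normSign σ f₀ : ℚ)],
         ![(normSign σ (-1 : K) : ℚ) * normSign σ f₁ * normSign σ (1 + f₁), (normSign σ (-1 : K) : ℚ) * normSign σ (1 + f₁), (normSign σ f₁ : ℚ)],
         ![(normSign σ f₂ : ℚ), (normSign σ (-1 : K) : ℚ) * normSign σ f₂ * normSign σ (1 + f₂), (normSign σ (-1 : K) : ℚ) * normSign σ (1 + f₂)]] : Fin 3 → Fin 3 → ℚ) 2 i) *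
      (((q : ℚ) ^ k - (q : ℚ) ^ (k - (nᵢ + 4 - 2 * (d % 2) - 3 * d) / 2)) / ((q : ℚ) - 1)) := by
    rw [← mul_div_assoc, eq_div_iff hq1', mul_comm]
    exact key
  rw [hsum]
  ring

end Summit.HodgeConjecture.HodgeConjecture.Cruxes.H413.F0P3cDyRamKappaCountTypeTwoSigned

end
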